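import Summits.CriticalPhenomena.PercolationContinuityZ3.Theorems.PercNearOneGluingNoHeavyQuantFarRelayRow
import Summits.CriticalPhenomena.PercolationContinuityZ3.Theorems.PercNearOneGluingNoHeavyQuantObserverFreeLevelFalse
import HarnessLib

/-!
# QUANT lane R8: the far-relay row (FAR) is sharp on both sides — two certified four-vertex witnesses

builds on p205010 (kernel theorem, internal audit signed; external expert review pending)

Support file (`--supports stmt-CriticalPhenomena-4575`), seat `prim-quant-census-1` (gen 5); memo
`run/shared/lean/prim/quant/CENSUS-GAIN.md` §13 (third FAR engine n ≤ 8, mass rows, climbs; §13.6b threshold census).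
No definitions, no named facts, no sorries.

`Quant.FarRelayRow` (FAR, `…QuantFarRelayRow.lean`): `2j < Σ_{a∈A} P(o ↔ a)` and `P(o ↮ a) ≤ t` on `A` imply
`P(#{a ∈ A | o ↔ a} ≤ j) ≤ t`.  Two kernel facts about the SHAPE of this (open) row:

* `QuantCensus.farRelayRow_conclusion_sharp` — **the conclusion `≤ t` cannot be improved to `≤ c·t` for any `c < 1`.**  Witness
  (the two-block equality family `T(1)` of the census): four vertices, `o = 0`, relays `A = {1, 2, 3}`, edges `{0,1}` and `{0,2}`
  of weight `3/4`, `{2,3}` of weight `1`; `j = 1`, `t = 1/4`: `Σ_a P(o ↔ a) = 9/4 > 2`, `P(o ↮ a) = 1/4` for every relay, and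
  `P(N ≤ 1) = P({0,2} closed) = 1/4 = t` exactly.
* `QuantCensus.farRelayRow_hypothesis_witness` — **the mean hypothesis cannot be weakened to `(149/100)·j < Σ_a P(o ↔ a)`**
  (so not below `3j/2`): the star `K_{1,3}` with spokes `499/1000`, `j = 1`, `t = 501/1000`: `Σ_a P(o ↔ a) = 1497/1000 > 149/100`,
  `P(o ↮ a) = 501/1000`, but `P(N ≤ 1) = 250749999/500000000 > t`.  (The independent three-star violates the FAR inequality
  exactly when its spoke weight is `< 1/2`, i.e. for every mean `< 3/2`; the census (§13.6b) finds no violator with mean `≥ 3j/2`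
  in any structure, while FAR asks `> 2j`.)

Method: `CertWeighted` machinery — `real_openConn_eq_wConn`, `real_compl_openConn_eq_wNotConn` (exact connection
probabilities of a listed weighting) and `QuantGluing.real_levelCount_ge` (the level event as a certified weighted count);
the rational checks on the `2³` configurations are closed by `native_decide` (computational proposal, as in p214402).
[cite: KozmaNitzan2024, Lemma 2 (p. 6), Conjecture 3 (p. 15)]
-/

namespace Summit.CriticalPhenomena.PercolationContinuityZ3.Theorems

open MeasureTheory
open Literature.Probability.LatticeModels Literature.Probability.Percolation
open Summit.CriticalPhenomena.PercolationContinuityZ3.Theorems.AdditiveGluing.Negative.Cert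

namespace QuantCensus

/-! ### Witness 1: the two-block family `T(1)` — conclusion attained -/

/-- The `T(1)` witness: `{0,1}`, `{0,2}` of weight `3/4`, `{2,3}` glued. [this work] -/
theorem tOne_wlist_nodup :
    (wPairs ([((0 : Fin 4), (1 : Fin 4), (3/4 : ℚ)), (0, 2, 3/4), (2, 3, 1)] : List (Fin 4 × Fin 4 × ℚ))).Nodup := by
  decide

/-- The `T(1)` witness weights lie in `[0, 1]`. [this work] -/
theorem tOne_wlist_unit :
    ∀ e ∈ ([((0 : Fin 4), (1 : Fin 4), (3/4 : ℚ)), (0, 2, 3/4), (2, 3, 1)] : List (Fin 4 × Fin 4 × ℚ)),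
      0 ≤ e.2.2 ∧ e.2.2 ≤ 1 := by
  intro e he
  simp only [List.mem_cons, List.mem_nil_iff, or_false] at he
  rcases he with rfl | rfl | rfl <;> norm_num

/-- The three rational facts of the `T(1)` witness (one `native_decide` over the `2³` configurations): (i) `2 < Σ_{a∈{1,2,3}} wConn 0 a`
(it is `9/4`), (ii) `wNotConn 0 a ≤ 1/4` on `{1,2,3}`, (iii) `1/4 ≤` the weighted count of the level test `#{a : 0 ↔ a} ≤ 1`. [this work] -/
theorem tOne_check :
    ((decide ((2 : ℚ) < (List.map (fun x => wConn (wtabs 4 ([((0 : Fin 4), (1 : Fin 4), (3/4 : ℚ)), (0, 2, 3/4), (2, 3, 1)] :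
        List (Fin 4 × Fin 4 × ℚ))) (0 : Fin 4) x) ([1, 2, 3] : List (Fin 4))).sum) &&
      List.all ([1, 2, 3] : List (Fin 4)) (fun a => decide (wNotConn (wtabs 4 ([((0 : Fin 4), (1 : Fin 4), (3/4 : ℚ)), (0, 2, 3/4),
        (2, 3, 1)] : List (Fin 4 × Fin 4 × ℚ))) (0 : Fin 4) a ≤ (1/4 : ℚ)))) &&
      decide ((1/4 : ℚ) ≤ (((wtabs 4 ([((0 : Fin 4), (1 : Fin 4), (3/4 : ℚ)), (0, 2, 3/4), (2, 3, 1)] :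
        List (Fin 4 × Fin 4 × ℚ))).map fun t =>
          if decide ((Finset.filter (fun x : Fin 4 => (t.1.getD (0 : Fin 4) 0).testBit x = true)
            (List.toFinset ([1, 2, 3] : List (Fin 4)))).card ≤ 1) then t.2 else 0).sum))) = true := by
  native_decide

open Classical in
/-- **FAR's conclusion is sharp**: for no `c < 1` does `2j < Σ_a P(o ↔ a)` together with `P(o ↮ a) ≤ t` on `A` imply
`P(N ≤ j) ≤ c·t` on every finite weighted graph — the two-block family `T(1)` (observer joined to one relay and to a glued pair of
relays by independent `3/4`-edges) has `P(N ≤ 1) = t = 1/4` with mean `9/4 > 2`. [this work] -/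
theorem farRelayRow_conclusion_sharp (c : ℝ) (hc : c < 1) :
    ¬ ∀ (n : ℕ) (w : Sym2 (Fin n) → unitInterval) (A : Finset (Fin n)) (o : Fin n) (j : ℕ) (t : ℝ),
      (2 * j : ℝ) < ∑ a ∈ A, (prodBernoulli w).real (openConn o a) →
      (∀ a ∈ A, (prodBernoulli w).real (openConn o a)ᶜ ≤ t) →
      (prodBernoulli w).real {ω : BondConfig (Fin n) | (A.filter fun a => ω ∈ openConn o a).card ≤ j} ≤ c * t := by
  intro h
  set l : List (Fin 4 × Fin 4 × ℚ) := [((0 : Fin 4), (1 : Fin 4), (3/4 : ℚ)), (0, 2, 3/4), (2, 3, 1)] with hl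
  have hnd : (wPairs l).Nodup := tOne_wlist_nodup
  have hq : ∀ e ∈ l, 0 ≤ e.2.2 ∧ e.2.2 ≤ 1 := tOne_wlist_unit
  set A : Finset (Fin 4) := List.toFinset ([1, 2, 3] : List (Fin 4)) with hA
  have hchk := tOne_check
  rw [Bool.and_eq_true, Bool.and_eq_true] at hchk
  obtain ⟨⟨h1, h2⟩, h3⟩ := hchk
  have hAnd : (([1, 2, 3] : List (Fin 4))).Nodup := by decide
  -- (i) the mean hypothesis
  have hEN : (2 * (1 : ℕ) : ℝ) < ∑ a ∈ A, (prodBernoulli (wOfList l)).real (openConn (0 : Fin 4) a) := by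
    have hsum : ∑ a ∈ A, (prodBernoulli (wOfList l)).real (openConn (0 : Fin 4) a) =
        ((∑ a ∈ A, wConn (wtabs 4 l) (0 : Fin 4) a : ℚ) : ℝ) := by
      rw [Rat.cast_sum]
      exact Finset.sum_congr rfl fun x _ => real_openConn_eq_wConn hnd hq 0 x
    rw [hsum]
    have h1' : (2 : ℚ) < ∑ a ∈ A, wConn (wtabs 4 l) (0 : Fin 4) a := by
      rw [hA, List.sum_toFinset _ hAnd]
      exact of_decide_eq_true h1
    have : ((2 : ℚ) : ℝ) < ((∑ a ∈ A, wConn (wtabs 4 l) (0 : Fin 4) a : ℚ) : ℝ) := by exact_mod_cast h1'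
    simpa using this
  -- (ii) the cut hypotheses with `t = 1/4`
  have hcut : ∀ a ∈ A, (prodBernoulli (wOfList l)).real (openConn (0 : Fin 4) a)ᶜ ≤ (((1/4 : ℚ)) : ℝ) := by
    intro a ha
    rw [real_compl_openConn_eq_wNotConn hnd hq 0 a]
    have ha' : a ∈ ([1, 2, 3] : List (Fin 4)) := by rw [hA, List.mem_toFinset] at ha; exact ha
    exact_mod_cast of_decide_eq_true (List.all_eq_true.1 h2 a ha')
  -- (iii) the level event has probability at least `1/4`
  have hlow : (((1/4 : ℚ)) : ℝ) ≤ (prodBernoulli (wOfList l)).real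
      {ω | (Finset.filter (fun x => ω ∈ openConn (0 : Fin 4) x) A).card ≤ 1} :=
    QuantGluing.real_levelCount_ge hnd hq 0 A 1 (of_decide_eq_true h3)
  -- the instance
  have hinst := h 4 (wOfList l) A 0 1 (((1/4 : ℚ)) : ℝ) hEN hcut
  have hq14 : (((1/4 : ℚ)) : ℝ) = (1/4 : ℝ) := by norm_num
  rw [hq14] at hinst hlow
  nlinarith

/-! ### Witness 2: the independent three-star just below spoke weight `1/2` — hypothesis not weakenable below `3j/2` -/

/-- The star witness: three spokes of weight `499/1000`. [this work] -/
theorem star_wlist_nodup :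
    (wPairs ([((0 : Fin 4), (1 : Fin 4), (499/1000 : ℚ)), (0, 2, 499/1000), (0, 3, 499/1000)] :
      List (Fin 4 × Fin 4 × ℚ))).Nodup := by
  decide

/-- The star witness weights lie in `[0, 1]`. [this work] -/
theorem star_wlist_unit :
    ∀ e ∈ ([((0 : Fin 4), (1 : Fin 4), (499/1000 : ℚ)), (0, 2, 499/1000), (0, 3, 499/1000)] : List (Fin 4 × Fin 4 × ℚ)),
      0 ≤ e.2.2 ∧ e.2.2 ≤ 1 := by
  intro e he
  simp only [List.mem_cons, List.mem_nil_iff, or_false] at he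
  rcases he with rfl | rfl | rfl <;> norm_num

/-- The three rational facts of the star witness (one `native_decide`): (i) `149/100 < Σ_a wConn 0 a` (it is `1497/1000`), (ii)
`wNotConn 0 a ≤ 501/1000`, (iii) `250749999/500000000 ≤` the weighted count of the level test `#{a : 0 ↔ a} ≤ 1`. [this work] -/
theorem star_check :
    ((decide ((149/100 : ℚ) < (List.map (fun x => wConn (wtabs 4 ([((0 : Fin 4), (1 : Fin 4), (499/1000 : ℚ)), (0, 2, 499/1000),
        (0, 3, 499/1000)] : List (Fin 4 × Fin 4 × ℚ))) (0 : Fin 4) x) ([1, 2, 3] : List (Fin 4))).sum) &&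
      List.all ([1, 2, 3] : List (Fin 4)) (fun a => decide (wNotConn (wtabs 4 ([((0 : Fin 4), (1 : Fin 4), (499/1000 : ℚ)),
        (0, 2, 499/1000), (0, 3, 499/1000)] : List (Fin 4 × Fin 4 × ℚ))) (0 : Fin 4) a ≤ (501/1000 : ℚ)))) &&
      decide ((250749999/500000000 : ℚ) ≤ (((wtabs 4 ([((0 : Fin 4), (1 : Fin 4), (499/1000 : ℚ)), (0, 2, 499/1000),
        (0, 3, 499/1000)] : List (Fin 4 × Fin 4 × ℚ))).map fun t =>
          if decide ((Finset.filter (fun x : Fin 4 => (t.1.getD (0 : Fin 4) 0).testBit x = true)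
            (List.toFinset ([1, 2, 3] : List (Fin 4)))).card ≤ 1) then t.2 else 0).sum))) = true := by
  native_decide

open Classical in
/-- **FAR's mean hypothesis cannot be weakened to `(149/100)·j < Σ_a P(o ↔ a)`** (in particular not below `(3/2)·j`):
the three-spoke star at weight `499/1000` has mean `1497/1000`, `max_a P(o ↮ a) = 501/1000`, and
`P(N ≤ 1) = 250749999/500000000 > 501/1000`. [this work] -/
theorem farRelayRow_hypothesis_witness :
    ¬ ∀ (n : ℕ) (w : Sym2 (Fin n) → unitInterval) (A : Finset (Fin n)) (o : Fin n) (j : ℕ) (t : ℝ),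
      (149 / 100 * j : ℝ) < ∑ a ∈ A, (prodBernoulli w).real (openConn o a) →
      (∀ a ∈ A, (prodBernoulli w).real (openConn o a)ᶜ ≤ t) →
      (prodBernoulli w).real {ω : BondConfig (Fin n) | (A.filter fun a => ω ∈ openConn o a).card ≤ j} ≤ t := by
  intro h
  set l : List (Fin 4 × Fin 4 × ℚ) := [((0 : Fin 4), (1 : Fin 4), (499/1000 : ℚ)), (0, 2, 499/1000), (0, 3, 499/1000)] with hl
  have hnd : (wPairs l).Nodup := star_wlist_nodup
  have hq : ∀ e ∈ l, 0 ≤ e.2.2 ∧ e.2.2 ≤ 1 := star_wlist_unit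
  set A : Finset (Fin 4) := List.toFinset ([1, 2, 3] : List (Fin 4)) with hA
  have hchk := star_check
  rw [Bool.and_eq_true, Bool.and_eq_true] at hchk
  obtain ⟨⟨h1, h2⟩, h3⟩ := hchk
  have hAnd : (([1, 2, 3] : List (Fin 4))).Nodup := by decide
  have hEN : (149 / 100 * (1 : ℕ) : ℝ) < ∑ a ∈ A, (prodBernoulli (wOfList l)).real (openConn (0 : Fin 4) a) := by
    have hsum : ∑ a ∈ A, (prodBernoulli (wOfList l)).real (openConn (0 : Fin 4) a) =
        ((∑ a ∈ A, wConn (wtabs 4 l) (0 : Fin 4) a : ℚ) : ℝ) := by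
      rw [Rat.cast_sum]
      exact Finset.sum_congr rfl fun x _ => real_openConn_eq_wConn hnd hq 0 x
    rw [hsum]
    have h1' : (149/100 : ℚ) < ∑ a ∈ A, wConn (wtabs 4 l) (0 : Fin 4) a := by
      rw [hA, List.sum_toFinset _ hAnd]
      exact of_decide_eq_true h1
    have : (((149/100 : ℚ)) : ℝ) < ((∑ a ∈ A, wConn (wtabs 4 l) (0 : Fin 4) a : ℚ) : ℝ) := by exact_mod_cast h1'
    norm_num at this ⊢
    exact this
  have hcut : ∀ a ∈ A, (prodBernoulli (wOfList l)).real (openConn (0 : Fin 4) a)ᶜ ≤ (((501/1000 : ℚ)) : ℝ) := by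
    intro a ha
    rw [real_compl_openConn_eq_wNotConn hnd hq 0 a]
    have ha' : a ∈ ([1, 2, 3] : List (Fin 4)) := by rw [hA, List.mem_toFinset] at ha; exact ha
    exact_mod_cast of_decide_eq_true (List.all_eq_true.1 h2 a ha')
  have hlow : (((250749999/500000000 : ℚ)) : ℝ) ≤ (prodBernoulli (wOfList l)).real
      {ω | (Finset.filter (fun x => ω ∈ openConn (0 : Fin 4) x) A).card ≤ 1} :=
    QuantGluing.real_levelCount_ge hnd hq 0 A 1 (of_decide_eq_true h3)
  have hinst := h 4 (wOfList l) A 0 1 (((501/1000 : ℚ)) : ℝ) hEN hcut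
  have hlt : (((501/1000 : ℚ)) : ℝ) < (((250749999/500000000 : ℚ)) : ℝ) := by norm_num
  linarith

end QuantCensus

end Summit.CriticalPhenomena.PercolationContinuityZ3.Theorems
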